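import Summits.ResolutionOfSingularities.ResolutionOfSingularities.Theorems.WeightedInvariantIota3SigmaSpecialise
import Summits.ResolutionOfSingularities.ResolutionOfSingularities.Theorems.WeightedInvariantIota3SigmaGenericFibre
import HarnessLib

/-!
# σ-DESCENT along `S → S(X)` modulo the specialisation of flags ((o39) sequel, (D-b) assembly)

Route `ResolutionOfSingularities/WeightedInvariant`, crux `Theses.WeightedInvariant.HypersurfaceCentreConstruction`
(stmt-ResolutionOfSingularities-19897), P3 rung, clause (c10σ); res-L1-w43-plan-1 RULING gen 11 #5 (2) Q2; design note
`plan/tools/res-type-057/SIGMA-DESCENT-SX.md` (res-type-057).  On top of `FlagReaches.exists_goodPoint_criterion` (p536350) this file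
isolates the ONE remaining input of the infinite-residue-field descent as an explicit hypothesis on the local ring `S`:

  `hspec` («flags of `S(X)` with polynomial members specialise»): for all `G₁ G₂ ∈ S[X]` with `(G₁/1, G₂/1)` a two-flag of `S(X)` and
  every finite set `B` of residues, some `a ∈ S` with residue outside `B` makes `(G₁(a), G₂(a))` a two-flag of `S`

— true when the residue field is INFINITE (finitely many bad residues: the zeros of a cotangent `2×2` minor; design note §(5), NOT
proved here) — and proves under it: `FlagReaches` DESCENDS along `S → S(X)` (`FlagReaches.of_genericFibre_of_spec`), hence with p530558
(`…_of_descent`) the letters `sigmaRatioNat`, `levelSet`, `iotaSigma` are EQUAL along `S → S(X)` (`iotaSigma_genericFibre_eq_of_spec`).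
The unit condition on the denominator `s ∉ 𝔪S[X]` is discharged here: `s̄ ≠ 0` in `κ[X]` has finitely many roots, and `s(a)` is a unit
as soon as `s̄(ā) ≠ 0` (`isUnit_aeval_of_eval_residue_ne_zero`).

Def-free helper (`--supports stmt-ResolutionOfSingularities-19897`); OURS bookkeeping; no claim about resolution in positive characteristic.
AI-written; weaker than expert review.  [OURS · L1 W4.3 · (o39) sequel]  [cite: Matsumura1987, §8]
-/

noncomputable section

set_option linter.dupNamespace false -- mandated namespace of this single-conjunct summit

open IsLocalRing Polynomial Literature.AlgebraicGeometry.Resolution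
open Summit.ResolutionOfSingularities.ResolutionOfSingularities.Theorems

namespace Summit.ResolutionOfSingularities.ResolutionOfSingularities.Cruxes.HypersurfaceCentreConstruction.LocalEngine

namespace Iota3

section Descent

variable {S : Type} [CommRing S] [IsLocalRing S]

/-- The residue of `s(a)` is `s̄(ā)`. [folklore] -/
theorem residue_aeval (a : S) (s : S[X]) :
    residue S (Polynomial.aeval a s) = (s.map (residue S)).eval (residue S a) := by
  rw [Polynomial.aeval_def, Polynomial.hom_eval₂, Polynomial.eval_map]
  rfl

/-- `s(a)` is a unit as soon as `s̄(ā) ≠ 0`. [folklore] -/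
theorem isUnit_aeval_of_eval_residue_ne_zero {a : S} {s : S[X]} (h : (s.map (residue S)).eval (residue S a) ≠ 0) :
    IsUnit (Polynomial.aeval a s) := by
  by_contra hu
  apply h
  rw [← residue_aeval, (IsLocalRing.residue_eq_zero_iff _).mpr ((IsLocalRing.mem_maximalIdeal _).mpr hu)]

/-- `s ∉ 𝔪S[X]` iff `s̄ ≠ 0` in `κ[X]`. [folklore] -/
theorem map_residue_ne_zero_of_not_mem {s : S[X]} (hs : s ∉ (maximalIdeal S).map (C : S →+* S[X])) :
    s.map (residue S) ≠ 0 := by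
  intro h0
  apply hs
  rw [Ideal.mem_map_C_iff]
  intro n
  have hn : (s.map (residue S)).coeff n = 0 := by rw [h0, Polynomial.coeff_zero]
  rw [Polynomial.coeff_map] at hn
  exact (IsLocalRing.residue_eq_zero_iff _).mp hn

/-- **DESCENT of reached weights along `S → S(X)`, modulo the specialisation of flags.** [folklore] -/
theorem FlagReaches.of_genericFibre_of_spec
    (hspec : ∀ G₁ G₂ : S[X],
      IsTwoFlag (algebraMap S[X] (Localization.AtPrime ((maximalIdeal S).map (C : S →+* S[X]))) G₁)
        (algebraMap S[X] (Localization.AtPrime ((maximalIdeal S).map (C : S →+* S[X]))) G₂) →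
      ∀ B : Finset (ResidueField S), ∃ a : S, residue S a ∉ B ∧ IsTwoFlag (Polynomial.aeval a G₁) (Polynomial.aeval a G₂))
    {f : S} {ν q r₁ r₂ : ℕ}
    (h : FlagReaches (algebraMap S[X] (Localization.AtPrime ((maximalIdeal S).map (C : S →+* S[X]))) (C f)) ν q r₁ r₂) :
    FlagReaches f ν q r₁ r₂ := by
  classical
  obtain ⟨G₁, G₂, s, hs, hflG, -, hgood⟩ := FlagReaches.exists_goodPoint_criterion h
  obtain ⟨a, haB, hfla⟩ := hspec G₁ G₂ hflG ((s.map (residue S)).roots.toFinset)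
  refine hgood a (isUnit_aeval_of_eval_residue_ne_zero fun h0 => haB ?_) hfla
  rw [Multiset.mem_toFinset, Polynomial.mem_roots (map_residue_ne_zero_of_not_mem hs)]
  exact h0

/-- With the specialisation of flags, `FlagReaches` is an `iff` along `S → S(X)`. [folklore] -/
theorem flagReaches_genericFibre_iff_of_spec
    (hspec : ∀ G₁ G₂ : S[X],
      IsTwoFlag (algebraMap S[X] (Localization.AtPrime ((maximalIdeal S).map (C : S →+* S[X]))) G₁)
        (algebraMap S[X] (Localization.AtPrime ((maximalIdeal S).map (C : S →+* S[X]))) G₂) →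
      ∀ B : Finset (ResidueField S), ∃ a : S, residue S a ∉ B ∧ IsTwoFlag (Polynomial.aeval a G₁) (Polynomial.aeval a G₂))
    (f : S) (ν q r₁ r₂ : ℕ) :
    FlagReaches (algebraMap S[X] (Localization.AtPrime ((maximalIdeal S).map (C : S →+* S[X]))) (C f)) ν q r₁ r₂ ↔
      FlagReaches f ν q r₁ r₂ :=
  ⟨FlagReaches.of_genericFibre_of_spec hspec, fun h => h.genericFibre⟩

/-- **`σ` is PRESERVED along `S → S(X)`, modulo the specialisation of flags** (with p530558's `…_of_descent`). [folklore] -/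
theorem iotaSigma_genericFibre_eq_of_spec
    (hspec : ∀ G₁ G₂ : S[X],
      IsTwoFlag (algebraMap S[X] (Localization.AtPrime ((maximalIdeal S).map (C : S →+* S[X]))) G₁)
        (algebraMap S[X] (Localization.AtPrime ((maximalIdeal S).map (C : S →+* S[X]))) G₂) →
      ∀ B : Finset (ResidueField S), ∃ a : S, residue S a ∉ B ∧ IsTwoFlag (Polynomial.aeval a G₁) (Polynomial.aeval a G₂))
    (f : S) :
    iotaSigma (Localization.AtPrime ((maximalIdeal S).map (C : S →+* S[X])))
        (algebraMap S[X] (Localization.AtPrime ((maximalIdeal S).map (C : S →+* S[X]))) (C f)) = iotaSigma S f := by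
  haveI := flat_genericFibre (S := S)
  have hdesc : ∀ ν q r₁ r₂ : ℕ,
      FlagReaches (algebraMap S (Localization.AtPrime ((maximalIdeal S).map (C : S →+* S[X]))) f) ν q r₁ r₂ →
        FlagReaches f ν q r₁ r₂ := fun ν q r₁ r₂ h => by
    rw [algebraMap_genericFibre_apply] at h
    exact FlagReaches.of_genericFibre_of_spec hspec h
  rw [← algebraMap_genericFibre_apply]
  exact iotaSigma_algebraMap_eq_of_descent map_maximalIdeal_genericFibre hdesc

end Descent

end Iota3

end Summit.ResolutionOfSingularities.ResolutionOfSingularities.Cruxes.HypersurfaceCentreConstruction.LocalEngine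

end
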